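import Mathlib
import Literature.RingTheory.CohomologyAnnihilator.ModuleDescentFiniteSubextension
import Summits.ResolutionOfSingularities.ResolutionOfSingularities.Theses.HomologicalConductor
import Summits.ResolutionOfSingularities.ResolutionOfSingularities.Theorems.HomologicalConductorPersistenceRadicalTower
import HarnessLib

/-!
# Rung S-3 `PersistenceRadical` UNCONDITIONALLY (Iyengar–Takahashi 5.4 is now a theorem)

Crux `HomologicalConductor.Persistence` (stmt-ResolutionOfSingularities-16484), chain W4.4b,
support item `PersistenceRadical` (stmt-ResolutionOfSingularities-19920). `[OURS · L1 w44b]` —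
replaces the role of no printed item; NOT a statement of any manuscript.

`Theorems/HomologicalConductorPersistenceRadicalTower.lean` (p465428) proved radical persistence
along the canonical tower GIVEN the named fact `singEqVCa_essFiniteType`
([IyengarTakahashi2014, Thm. 5.4]). That fact is now DISCHARGED in the tree
(`Literature.RingTheory.CohomologyAnnihilator.singEqVCa_essFiniteType_holds`, chain W4.4,
`ModuleDescentFiniteSubextension.lean` p470293), so every statement of that file and of
`…PersistenceRadical.lean` holds unconditionally:

* `Theorems.persistenceRadical_proof : HomologicalConductor.PersistenceRadical` — the route decl BY
  NAME (item stmt-ResolutionOfSingularities-19920): for every prime `p`, fields `k` (`CharP k p`) `⊆ K`,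
  valuation ring `O ⊇ k`, finitely generated `A ⊆ O` with `Frac A = K`, every `m` and every
  `x ∈ ca (T_m)`, some `x ^ N`, `N ≥ 1`, lies in `ca (T_(m+1))`;
* `persistenceRadical_tower_holds` — the same over the named tower `NoZeno.Birth.{ca, tower}`,
  char-free;
* `radicalPersistence_holds`, `radicalPersistence_locAt_holds` — the chart-level forms (H-c)
  without any hypothesis beyond `B` essentially of finite type with `Frac B = K` (and `B ⊆ O`,
  `ca B / x ⊆ O` for the local form).

References: S. B. Iyengar, R. Takahashi, *Annihilation of cohomology and strong generation of
module categories*, IMRN 2016 [`IyengarTakahashi2014`].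
-/

-- single-problem summit: the doubled namespace component `ResolutionOfSingularities` is forced
set_option linter.dupNamespace false

noncomputable section

namespace Summit.ResolutionOfSingularities.ResolutionOfSingularities.Theorems

open Summit.ResolutionOfSingularities.ResolutionOfSingularities.Theses.HomologicalConductor
open Literature.RingTheory.CohomologyAnnihilator (singEqVCa_essFiniteType_holds)

/-! ## The item `PersistenceRadical` (stmt-ResolutionOfSingularities-19920), BY NAME -/

/-- **Rung S-3 `PersistenceRadical` (stmt-ResolutionOfSingularities-19920) PROVED — the route decl
BY NAME, unconditionally**: along the canonical normalised `ca`-tower of a finitely generated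
`A ⊆ O` with `Frac A = K`, every `x ∈ ca (T_m)` has a power `x ^ N`, `N ≥ 1`, in `ca (T_(m+1))`.
Proof: `PersistenceRadical.persistenceRadical_route` (p465428) at Iyengar–Takahashi's Theorem 5.4,
now the tree theorem `singEqVCa_essFiniteType_holds` (chain W4.4, p470293); the named tower
`NoZeno.Birth.{ca, loc, chart, nrm, tower}` is the route's `let`s verbatim, so the last step is
re-abstraction. Mechanism (OURS): the normalised chart is regular off `V(x)` and `V(ca) = Sing`
upstairs, so `x ∈ √ca`. [cite: IyengarTakahashi2014, Thm. 5.4] -/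
theorem persistenceRadical_proof : PersistenceRadical :=
  fun p hp k K _ _ _ _ O A hk hA hfr hAO =>
    HomologicalConductor.PersistenceRadical.persistenceRadical_route singEqVCa_essFiniteType_holds
      p hp k K O A hk hA hfr hAO

end Summit.ResolutionOfSingularities.ResolutionOfSingularities.Theorems

namespace Summit.ResolutionOfSingularities.ResolutionOfSingularities.Theorems.HomologicalConductor.PersistenceRadical

open Literature.RingTheory.CohomologyAnnihilator (singEqVCa_essFiniteType_holds)
open Summit.ResolutionOfSingularities.ResolutionOfSingularities.Theorems.NoZeno.Birth (ca nrm loc tower)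

/-! ## Named-tower and chart-level forms, unconditional -/

variable {k K : Type} [Field k] [Field K] [Algebra k K]

/-- **Radical persistence along the canonical tower, char-free, UNCONDITIONAL** (over the named
tower `NoZeno.Birth.tower`): every `x ∈ ca (T_m)` has `x ^ N ∈ ca (T_(m+1))` for some `N ≥ 1`.
[cite: IyengarTakahashi2014, Thm. 5.4] -/
theorem persistenceRadical_tower_holds (O : ValuationSubring K) (A : Subalgebra k K)
    (hk : ∀ c : k, algebraMap k K c ∈ O) (hA : A.FG) (hfr : IsFractionRing ↥A K)
    (hAO : A.toSubring ≤ O.toSubring) (m : ℕ) {x : K} (hx : x ∈ ca (tower O A m)) :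
    ∃ N : ℕ, 1 ≤ N ∧ x ^ N ∈ ca (tower O A (m + 1)) :=
  persistenceRadical_tower singEqVCa_essFiniteType_holds O A hk hA hfr hAO m hx

/-- **H-c UNCONDITIONAL**: for `B ⊆ K` essentially of finite type over `k` with `Frac B = K` and
`x ∈ ca B`, some `x ^ N`, `N ≥ 1`, lies in `ca (nrm (B[ca B / x]))`.
[cite: IyengarTakahashi2014, Thm. 5.4] -/
theorem radicalPersistence_holds (B : Subalgebra k K) (x : K) (hBft : Algebra.EssFiniteType k ↥B)
    (hBfrac : IsFractionRing ↥B K) (hx : x ∈ ca B) :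
    ∃ N : ℕ, 1 ≤ N ∧ x ^ N ∈ ca (nrm (Algebra.adjoin k ((B : Set K) ∪
      {y : K | ∃ c ∈ ca B, y = c * x⁻¹}))) :=
  radicalPersistence_of_singEqVCa singEqVCa_essFiniteType_holds B x hBft hBfrac hx

/-- **H-c at the centre of a valuation ring, UNCONDITIONAL**: for `B ⊆ O` essentially of finite
type with `Frac B = K` and `x ∈ ca B` with `c * x⁻¹ ∈ O` for all `c ∈ ca B`, some `x ^ N`, `N ≥ 1`,
lies in `ca (loc O (nrm (B[ca B / x])))` — the radical twin of the local core stub R1.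
[cite: IyengarTakahashi2014, Thm. 5.4] -/
theorem radicalPersistence_locAt_holds (O : ValuationSubring K) (B : Subalgebra k K) (x : K)
    (hBft : Algebra.EssFiniteType k ↥B) (hBfrac : IsFractionRing ↥B K)
    (hBO : B.toSubring ≤ O.toSubring) (hx : x ∈ ca B) (hmin : ∀ c ∈ ca B, c * x⁻¹ ∈ O) :
    ∃ N : ℕ, 1 ≤ N ∧ x ^ N ∈ ca (loc O (nrm (Algebra.adjoin k ((B : Set K) ∪
      {y : K | ∃ c ∈ ca B, y = c * x⁻¹})))) :=
  radicalPersistence_locAt_of_singEqVCa singEqVCa_essFiniteType_holds O B x hBft hBfrac hBO hx hmin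

end Summit.ResolutionOfSingularities.ResolutionOfSingularities.Theorems.HomologicalConductor.PersistenceRadical

end
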